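/-
Copyright: statement-level skeleton of a published paper (lit-balaban cell, Phase-2 proof seat p10, gen 3). No proof claims
beyond what the kernel checks below.
-/
import Mathlib
import Literature.MathematicalPhysics.QuantumFieldTheory.BalabanImbrieJaffe1984to88.BIJ85Tau0Positivity729
import Literature.MathematicalPhysics.QuantumFieldTheory.Balaban1983to89.B5Prop11Leaves

/-!
# `BalabanImbrieJaffe1984to88.BIJ85AveragingSums716` — T. Bałaban, J. Imbrie, A. Jaffe, *Renormalization of the Higgs model:
minimizers, propagators and the stability of mean field theory*, Commun. Math. Phys. **97** (1985) 299–329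
[BalabanImbrieJaffe1985]: Sect. 7.1 pp. 322–324 — uniform bounds on the averaging sums a_μ(p′) (7.1.16) and φ_ν(p′) (7.1.10)
of r15's momentum symbols, the inputs of (7.1.23) *"|a_μ(p)/φ_ν(p)^{1/2}| ≤ c₂ … is an extension of (7.1.20)"* — PROVED

statement-level skeleton of published theorems with citation tags; proofs where landed; nothing here is a claim about
the Yang–Mills mass gap

PDF held: `paper:balaban1985-cmp97-bij-higgs-minimizers` (journal page = PDF page + 298).  Renders read as images: PDF pp.
24–26 (journal 322–324), `run/shared/lean/pub/pub-balaban/t4/b2b-balaban-t4-lit2/renders/bij1985/…-p024…p026-x2.png`.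

CITATION HEADER (lean-in-tree rule).  Part of the lit-balaban TYPED SKELETON (HOME `run/shared/lean/pub/lit-balaban/`); WHAT IS
REPRODUCED: the (unprinted) elementary estimates behind display (7.1.23) of SKELETON row **C1.Prop7.1.2** (*"Proof
(7.1.22)–(7.1.27)"*, `HOME/lit-balaban-r15/ROWS-C1.md`, fold owner r15, referee ref-5); file 1/3 of seat p10 gen 3's model
instance of Proposition 7.1.2 / Theorem 7.1.1 (`BIJ85Tau2Bound724`: (7.1.24); `BIJ85Thm711Fibrewise`: (7.1.23), `Prop712`,
`Thm711`).  Inputs (read-only): r15's `BIJ85MomentumSymbols71` — ∂(p) (7.1.4) `dSym`, ∂^{(1)} (7.1.5) `dOne`, Δ (7.1.6) `lapSym`,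
v_μ (7.1.7) `vSym`, u (7.1.9) `uSym`, the index set `lShifts d M`/`shiftMom` and φ_μ (7.1.10) `phiSym`, a_μ (7.1.16) `aSym`; gen-2
`BIJ85Tau0Positivity729.norm_vSym_bounds`/`norm_uSym_bounds` ((7.1.20)); `Balaban1983to89.B5Prop11Leaves.abs_sin_nat_mul_le`
(|sin nθ| ≤ n|sin θ|, the [6I] leaf behind |v_μ| ≤ 1).

SETTING.  η = L^{−k} = 1/n, n ∈ ℕ, n ≥ 1 (p. 322 *"|p_i| ≤ π/η = πL^k"*); the l-sums of (7.1.10)/(7.1.16) run over l = 2πm,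
|m_i| ≤ M with **2M + 1 ≤ n** (r15's `lShifts d M`; for n = L^k odd and 2M + 1 = n this IS the printed range |l_i| ≤ π/η;
every bound below is uniform in n and M under this constraint); momenta p with 0 < |p_i| ≤ π (r15's typed v_μ(p) is the
junk value 0 at p_μ = 0, where print has 1 by continuity — transcript note T10 of ROWS-C1; a Lebesgue-null set).

WHAT IS KERNEL-CHECKED (zero `sorry`, standard axioms), all constants explicit and depending on d only:
* leaves at η = 1/n: |∂^{(1)}_ρ(q)| ≤ |∂_ρ(q)|, |v_ρ(q)| ≤ 1 at EVERY q (`norm_dOne_le_norm_dSym`, `norm_vSym_le_one`); for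
  l = 2πm, m_ρ ≠ 0: |∂_ρ(p + l)| ≥ 2|m_ρ| (Jordan's inequality, `two_mul_abs_le_norm_dSym`), |v_ρ(p + l)| ≤ 1/|m_ρ|
  (`norm_vSym_shift_le`); Δ(p) ≤ dπ² (`lapSym_le`); |∂^{(1)}_λ(p)|² ≤ Δ(p) (`norm_dOne_sq_le_lapSym`);
* the l-terms of (7.1.16): (|u/v_μ|²Δ^{−1})(p + l) = Π_{ρ≠μ}|v_ρ(p + l)|²/Δ(p + l) (`aTerm_eq_prod`), ≤ 1/Δ(p) at l = 0 and
  ≤ ¼Π_ρ w(m_ρ) at l ≠ 0, w(0) = 1, w(j) = 1/j² (`aTerm_shift_le`); Σ_l ≤ 1/Δ(p) + ¼K₀^d, K₀ = 1 + Σ_{j∈ℤ}1/j²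
  (`sum_aTerm_le`), whence **|a_μ(p)| ≤ |∂^{(1)}_μ(p)|·(1/Δ(p) + ¼K₀^d)** (`norm_aSym_le`);
* **φ_ν(p) ≥ (2/π)^{2d+2}/Δ(p)** (its l = 0 term and (7.1.20); `phiSym_ge`, `phiSym_pos`).
NOT here: (7.1.23) itself, (7.1.24) (companion files).  Unit `lit-balaban-p10` (gen 3), HOME as above.
-/

namespace Literature.MathematicalPhysics.QuantumFieldTheory.BalabanImbrieJaffe1984to88.BIJ85AveragingSums716

open scoped BigOperators Real ComplexConjugate
open Finset
open Literature.MathematicalPhysics.QuantumFieldTheory.BalabanImbrieJaffe1984to88.BIJ85MomentumSymbols71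
open Literature.MathematicalPhysics.QuantumFieldTheory.BalabanImbrieJaffe1984to88.BIJ85Tau0Positivity729
open Literature.MathematicalPhysics.QuantumFieldTheory.Balaban1983to89.B5Prop11Leaves (abs_sin_nat_mul_le)

noncomputable section

variable {d : ℕ}

/-! ## §1 One-variable leaves at η = L^{−k} = 1/n -/

/-- |∂_ρ(q)| = 2n|sin(q_ρ/2n)| at η = 1/n ((7.1.4)). [cite: BalabanImbrieJaffe1985, (7.1.4) p.322] -/
theorem norm_dSym_inv_nat {n : ℕ} (hn : 0 < n) (q : Fin d → ℝ) (ρ : Fin d) :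
    ‖dSym ((n : ℝ)⁻¹) q ρ‖ = 2 * n * |Real.sin (q ρ / (2 * n))| := by
  have hn' : (0 : ℝ) < n := by exact_mod_cast hn
  rw [norm_dSym (inv_pos.mpr hn'), show (n : ℝ)⁻¹ * q ρ / 2 = q ρ / (2 * n) by field_simp]
  field_simp

/-- |∂^{(1)}_ρ(q)| ≤ |∂_ρ(q)| at every momentum q (η = 1/n): |sin nθ| ≤ n|sin θ| with θ = q_ρ/2n — the [6I] leaf E3.
[cite: BalabanImbrieJaffe1985, (7.1.7) p.322] -/
theorem norm_dOne_le_norm_dSym {n : ℕ} (hn : 0 < n) (q : Fin d → ℝ) (ρ : Fin d) :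
    ‖dOne q ρ‖ ≤ ‖dSym ((n : ℝ)⁻¹) q ρ‖ := by
  rw [norm_dOne, norm_dSym_inv_nat hn]
  have h := abs_sin_nat_mul_le n (q ρ / (2 * n))
  have hn' : (n : ℝ) ≠ 0 := by exact_mod_cast hn.ne'
  rw [show (n : ℝ) * (q ρ / (2 * n)) = q ρ / 2 by field_simp] at h
  linarith

/-- |v_ρ(q)| ≤ 1 at every momentum q (η = 1/n; where ∂_ρ(q) = 0 the typed quotient is 0). [cite: BalabanImbrieJaffe1985, (7.1.20) p.323] -/
theorem norm_vSym_le_one {n : ℕ} (hn : 0 < n) (q : Fin d → ℝ) (ρ : Fin d) : ‖vSym ((n : ℝ)⁻¹) q ρ‖ ≤ 1 := by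
  rw [vSym_eq, norm_div]
  exact div_le_one_of_le₀ (norm_dOne_le_norm_dSym hn q ρ) (norm_nonneg _)

/-- |∂^{(1)}_ρ(q)| ≤ 2. [cite: BalabanImbrieJaffe1985, (7.1.5) p.322] -/
theorem norm_dOne_le_two (q : Fin d → ℝ) (ρ : Fin d) : ‖dOne q ρ‖ ≤ 2 := by
  rw [norm_dOne]
  linarith [Real.abs_sin_le_one (q ρ / 2)]

/-- On r15's index set: |m_ρ| ≤ M. [cite: BalabanImbrieJaffe1985, (7.1.10) p.322] -/
theorem abs_le_of_mem_lShifts {M : ℕ} {m : Fin d → ℤ} (hm : m ∈ lShifts d M) (ρ : Fin d) : |(m ρ : ℝ)| ≤ M := by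
  have h := Finset.mem_Icc.mp (Fintype.mem_piFinset.mp hm ρ)
  rw [← Int.cast_abs]
  exact_mod_cast abs_le.mpr ⟨h.1, h.2⟩

/-- **The Jordan leaf**: at η = 1/n with 2M + 1 ≤ n, for |p_ρ| ≤ π and a shift l = 2πm, |m_i| ≤ M, with m_ρ ≠ 0:
|∂_ρ(p + l)| ≥ 2|m_ρ| (so Δ(p + l) ≥ 4m_ρ² ≥ 4).  Proof: π|m_ρ| ≤ |p_ρ + 2πm_ρ| ≤ π(2M + 1) ≤ πn and (2/π)x ≤ sin x on
[0, π/2]. [cite: BalabanImbrieJaffe1985, (7.1.23) p.324] -/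
theorem two_mul_abs_le_norm_dSym {n M : ℕ} (hMn : 2 * M + 1 ≤ n) {p : Fin d → ℝ} {ρ : Fin d} (hp : |p ρ| ≤ π)
    {m : Fin d → ℤ} (hm : m ∈ lShifts d M) (hρ : m ρ ≠ 0) :
    2 * |(m ρ : ℝ)| ≤ ‖dSym ((n : ℝ)⁻¹) (shiftMom p m) ρ‖ := by
  have hn : 0 < n := by omega
  have hn' : (0 : ℝ) < n := by exact_mod_cast hn
  rw [norm_dSym_inv_nat hn]
  simp only [shiftMom]
  set x : ℝ := p ρ + 2 * π * (m ρ : ℝ) with hx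
  have hmM : |(m ρ : ℝ)| ≤ M := abs_le_of_mem_lShifts hm ρ
  have hm1 : 1 ≤ |(m ρ : ℝ)| := by rw [← Int.cast_abs, ← Int.cast_one]; exact_mod_cast Int.one_le_abs hρ
  have hMn' : (2 * M + 1 : ℝ) ≤ n := by exact_mod_cast hMn
  -- |x| ≤ π n
  have hx_le : |x| ≤ π * n := by
    calc |x| ≤ |p ρ| + |2 * π * (m ρ : ℝ)| := abs_add_le _ _
      _ = |p ρ| + 2 * π * |(m ρ : ℝ)| := by
          rw [abs_mul, abs_of_pos (by positivity : (0 : ℝ) < 2 * π)]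
      _ ≤ π + 2 * π * M := by gcongr
      _ = π * (2 * M + 1) := by ring
      _ ≤ π * n := by gcongr
  -- π |m_ρ| ≤ |x|
  have hx_ge : π * |(m ρ : ℝ)| ≤ |x| := by
    have h1 : |2 * π * (m ρ : ℝ)| - |p ρ| ≤ |x| := by
      have := abs_sub_abs_le_abs_sub (2 * π * (m ρ : ℝ)) (-p ρ)
      rwa [abs_neg, sub_neg_eq_add, add_comm] at this
    rw [abs_mul, abs_of_pos (by positivity : (0 : ℝ) < 2 * π)] at h1
    nlinarith [Real.pi_pos]
  -- Jordan: (2/π)(|x|/2n) ≤ |sin(x/2n)|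
  have key : 2 / π * (|x| / (2 * n)) ≤ |Real.sin (x / (2 * n))| := by
    have h0 : 0 ≤ |x| / (2 * n) := by positivity
    have h1 : |x| / (2 * n) ≤ π / 2 := by
      rw [div_le_iff₀ (by positivity)]
      nlinarith [Real.pi_pos]
    have hj := Real.mul_le_sin h0 h1
    rcases le_or_gt 0 x with hx0 | hx0
    · rw [abs_of_nonneg hx0] at hj ⊢
      exact hj.trans (le_abs_self _)
    · rw [abs_of_neg hx0] at hj ⊢
      have : Real.sin (-x / (2 * n)) = -Real.sin (x / (2 * n)) := by rw [neg_div, Real.sin_neg]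
      rw [this] at hj
      exact hj.trans (neg_le_abs _)
  calc 2 * |(m ρ : ℝ)| = 2 / π * (π * |(m ρ : ℝ)|) := by field_simp
    _ ≤ 2 / π * |x| := by gcongr
    _ = 2 * n * (2 / π * (|x| / (2 * n))) := by field_simp
    _ ≤ 2 * n * |Real.sin (x / (2 * n))| := by gcongr

/-- Hence |v_ρ(p + l)| ≤ 1/|m_ρ| for m_ρ ≠ 0 (|∂^{(1)}_ρ| ≤ 2). [cite: BalabanImbrieJaffe1985, (7.1.23) p.324] -/
theorem norm_vSym_shift_le {n M : ℕ} (hMn : 2 * M + 1 ≤ n) {p : Fin d → ℝ} {ρ : Fin d} (hp : |p ρ| ≤ π)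
    {m : Fin d → ℤ} (hm : m ∈ lShifts d M) (hρ : m ρ ≠ 0) :
    ‖vSym ((n : ℝ)⁻¹) (shiftMom p m) ρ‖ ≤ 1 / |(m ρ : ℝ)| := by
  have hpos : 0 < |(m ρ : ℝ)| := abs_pos.mpr (Int.cast_ne_zero.mpr hρ)
  rw [vSym_eq, norm_div]
  calc ‖dOne (shiftMom p m) ρ‖ / ‖dSym ((n : ℝ)⁻¹) (shiftMom p m) ρ‖ ≤ 2 / (2 * |(m ρ : ℝ)|) :=
        div_le_div₀ (by norm_num) (norm_dOne_le_two _ _) (by positivity) (two_mul_abs_le_norm_dSym hMn hp hm hρ)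
    _ = 1 / |(m ρ : ℝ)| := by field_simp

/-- The summable weight of the l-sums, w(0) = 1, w(j) = 1/j² (j ≠ 0), is written below without case split as
`1 / (j : ℝ) ^ 2 + if j = 0 then 1 else 0` (Lean's 1/0² = 0; this file introduces no definitions); w ≥ 0.
[cite: BalabanImbrieJaffe1985, (7.1.23) p.324] -/
theorem wgt_nonneg (j : ℤ) : (0 : ℝ) ≤ 1 / (j : ℝ) ^ 2 + if j = 0 then (1 : ℝ) else 0 := by positivity

/-- |v_ρ(p + l)|² ≤ w(m_ρ) for every shift of r15's index set (2M + 1 ≤ n, |p_ρ| ≤ π). [cite: BalabanImbrieJaffe1985, (7.1.23) p.324] -/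
theorem norm_vSym_shift_sq_le_wgt {n M : ℕ} (hMn : 2 * M + 1 ≤ n) {p : Fin d → ℝ} {ρ : Fin d} (hp : |p ρ| ≤ π)
    {m : Fin d → ℤ} (hm : m ∈ lShifts d M) :
    ‖vSym ((n : ℝ)⁻¹) (shiftMom p m) ρ‖ ^ 2 ≤ (1 / (m ρ : ℝ) ^ 2 + if m ρ = 0 then (1 : ℝ) else 0) := by
  have hn : 0 < n := by omega
  by_cases hρ : m ρ = 0
  · rw [if_pos hρ, hρ]
    simp only [Int.cast_zero, ne_eq, OfNat.ofNat_ne_zero, not_false_eq_true, zero_pow, div_zero, zero_add]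
    have h := norm_vSym_le_one hn (shiftMom p m) ρ
    have h0 := norm_nonneg (vSym ((n : ℝ)⁻¹) (shiftMom p m) ρ)
    nlinarith
  · rw [if_neg hρ, add_zero]
    calc ‖vSym ((n : ℝ)⁻¹) (shiftMom p m) ρ‖ ^ 2 ≤ (1 / |(m ρ : ℝ)|) ^ 2 :=
          pow_le_pow_left₀ (norm_nonneg _) (norm_vSym_shift_le hMn hp hm hρ) 2
      _ = 1 / (m ρ : ℝ) ^ 2 := by rw [div_pow, one_pow, sq_abs]

/-- Δ(p + l) ≥ 4m_ρ², i.e. Δ(p + l)⁻¹ ≤ ¼·(1/m_ρ²), whenever m_ρ ≠ 0. [cite: BalabanImbrieJaffe1985, (7.1.23) p.324] -/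
theorem inv_lapSym_shift_le {n M : ℕ} (hMn : 2 * M + 1 ≤ n) {p : Fin d → ℝ} {ρ : Fin d} (hp : |p ρ| ≤ π)
    {m : Fin d → ℤ} (hm : m ∈ lShifts d M) (hρ : m ρ ≠ 0) :
    (lapSym ((n : ℝ)⁻¹) (shiftMom p m))⁻¹ ≤ 1 / 4 * (1 / (m ρ : ℝ) ^ 2) := by
  have hpos : 0 < |(m ρ : ℝ)| := abs_pos.mpr (Int.cast_ne_zero.mpr hρ)
  have h4 : 4 * (m ρ : ℝ) ^ 2 ≤ lapSym ((n : ℝ)⁻¹) (shiftMom p m) := by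
    calc 4 * (m ρ : ℝ) ^ 2 = (2 * |(m ρ : ℝ)|) ^ 2 := by rw [mul_pow, sq_abs]; norm_num
      _ ≤ ‖dSym ((n : ℝ)⁻¹) (shiftMom p m) ρ‖ ^ 2 :=
          pow_le_pow_left₀ (by positivity) (two_mul_abs_le_norm_dSym hMn hp hm hρ) 2
      _ ≤ lapSym ((n : ℝ)⁻¹) (shiftMom p m) :=
          Finset.single_le_sum (f := fun i => ‖dSym ((n : ℝ)⁻¹) (shiftMom p m) i‖ ^ 2) (fun _ _ => sq_nonneg _)
            (Finset.mem_univ ρ)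
  calc (lapSym ((n : ℝ)⁻¹) (shiftMom p m))⁻¹ ≤ (4 * (m ρ : ℝ) ^ 2)⁻¹ := inv_anti₀ (by positivity) h4
    _ = 1 / 4 * (1 / (m ρ : ℝ) ^ 2) := by rw [mul_inv]; ring

/-! ## §2 The l-terms of (7.1.16) and their sum -/

/-- a_μ(p′) = ∂^{(1)}_μ(p′)·Σ_l (|u/v_μ|²Δ^{−1})(p′ + l), the l-terms of **(7.1.16)** as real numbers (definitional unfolding
of r15's `aSym`). [cite: BalabanImbrieJaffe1985, (7.1.16) p.323] -/
theorem aSym_eq (η : ℝ) (M : ℕ) (p : Fin d → ℝ) (μ : Fin d) :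
    aSym η M p μ = dOne p μ *
      ((∑ m ∈ lShifts d M, (‖uSym η (shiftMom p m) / vSym η (shiftMom p m) μ‖ ^ 2 * (lapSym η (shiftMom p m))⁻¹) : ℝ) : ℂ) := by
  rw [aSym, Complex.ofReal_sum]

/-- each l-term of (7.1.16) is ≥ 0. [cite: BalabanImbrieJaffe1985, (7.1.16) p.323] -/
theorem aTerm_nonneg (η : ℝ) (q : Fin d → ℝ) (μ : Fin d) :
    0 ≤ (‖uSym η q / vSym η q μ‖ ^ 2 * (lapSym η q)⁻¹) := mul_nonneg (sq_nonneg _) (inv_nonneg.mpr (Finset.sum_nonneg fun _ _ => sq_nonneg _))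

/-- |u/v_μ|²(q) = Π_{ρ≠μ}|v_ρ(q)|² (u = Π_ρ v_ρ, (7.1.9)), when v_μ(q) ≠ 0. [cite: BalabanImbrieJaffe1985, (7.1.9) p.322] -/
theorem aTerm_eq_prod {η : ℝ} {q : Fin d → ℝ} {μ : Fin d} (hv : vSym η q μ ≠ 0) :
    (‖uSym η q / vSym η q μ‖ ^ 2 * (lapSym η q)⁻¹) = (∏ ρ ∈ Finset.univ.erase μ, ‖vSym η q ρ‖ ^ 2) * (lapSym η q)⁻¹ := by
  congr 1
  rw [uSym_eq_prod, ← Finset.mul_prod_erase Finset.univ (vSym η q) (Finset.mem_univ μ), mul_div_cancel_left₀ _ hv,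
    norm_prod, Finset.prod_pow]

/-- Generic momenta: at η = 1/n, a momentum p with 0 < |p_i| ≤ π has ∂^{(1)}(p), ∂(p + l) and v(p + l) componentwise ≠ 0 at
every shift l ∈ 2πℤ^d (|∂_ρ(p + l)| ≥ |∂^{(1)}_ρ(p)| = 2|sin(p_ρ/2)| > 0). [cite: BalabanImbrieJaffe1985, (7.1.8) p.322] -/
theorem generic_shift {n : ℕ} (hn : 0 < n) {p : Fin d → ℝ} (hp : ∀ i, p i ≠ 0 ∧ |p i| ≤ π) (m : Fin d → ℤ) (ρ : Fin d) :
    dOne p ρ ≠ 0 ∧ dSym ((n : ℝ)⁻¹) (shiftMom p m) ρ ≠ 0 ∧ vSym ((n : ℝ)⁻¹) (shiftMom p m) ρ ≠ 0 := by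
  have h1 : dOne p ρ ≠ 0 := by
    rw [← norm_ne_zero_iff, norm_dOne]
    have hlo : -π < p ρ / 2 := by linarith [(abs_le.mp (hp ρ).2).1, Real.pi_pos]
    have hhi : p ρ / 2 < π := by linarith [(abs_le.mp (hp ρ).2).2, Real.pi_pos]
    have hs : Real.sin (p ρ / 2) ≠ 0 := fun h0 =>
      (hp ρ).1 (by linarith [(Real.sin_eq_zero_iff_of_lt_of_lt hlo hhi).mp h0])
    simpa using hs
  have h2 : dSym ((n : ℝ)⁻¹) (shiftMom p m) ρ ≠ 0 := by
    rw [← norm_ne_zero_iff]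
    intro h0
    have hle := norm_dOne_le_norm_dSym hn (shiftMom p m) ρ
    rw [h0, dOne_shiftMom, norm_le_zero_iff] at hle
    exact h1 hle
  refine ⟨h1, h2, ?_⟩
  rw [vSym_eq, dOne_shiftMom]
  exact div_ne_zero h1 h2

/-- Δ(q) > 0 at such momenta (d ≥ 1). [cite: BalabanImbrieJaffe1985, (7.1.6) p.322] -/
theorem lapSym_shift_pos {n : ℕ} (hn : 0 < n) (hd : 0 < d) {p : Fin d → ℝ} (hp : ∀ i, p i ≠ 0 ∧ |p i| ≤ π)
    (m : Fin d → ℤ) : 0 < lapSym ((n : ℝ)⁻¹) (shiftMom p m) := by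
  have hρ : (⟨0, hd⟩ : Fin d) ∈ Finset.univ := Finset.mem_univ _
  have hpos : 0 < ‖dSym ((n : ℝ)⁻¹) (shiftMom p m) ⟨0, hd⟩‖ ^ 2 :=
    pow_pos (norm_pos_iff.mpr (generic_shift hn hp m ⟨0, hd⟩).2.1) 2
  exact lt_of_lt_of_le hpos (Finset.single_le_sum (f := fun i => ‖dSym ((n : ℝ)⁻¹) (shiftMom p m) i‖ ^ 2)
    (fun _ _ => sq_nonneg _) hρ)

/-- The l = 0 term: (|u/v_μ|²Δ^{−1})(p) ≤ 1/Δ(p) (each |v_ρ| ≤ 1). [cite: BalabanImbrieJaffe1985, (7.1.16) p.323] -/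
theorem aTerm_zero_le {n : ℕ} (hn : 0 < n) {p : Fin d → ℝ} (hp : ∀ i, p i ≠ 0 ∧ |p i| ≤ π) (μ : Fin d) :
    (‖uSym ((n : ℝ)⁻¹) p / vSym ((n : ℝ)⁻¹) p μ‖ ^ 2 * (lapSym ((n : ℝ)⁻¹) p)⁻¹) ≤ (lapSym ((n : ℝ)⁻¹) p)⁻¹ := by
  have hv := (generic_shift hn hp 0 μ).2.2
  rw [shiftMom_zero] at hv
  rw [aTerm_eq_prod hv]
  have h1 : ∏ ρ ∈ Finset.univ.erase μ, ‖vSym ((n : ℝ)⁻¹) p ρ‖ ^ 2 ≤ 1 :=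
    Finset.prod_le_one (fun _ _ => sq_nonneg _) fun ρ _ => by
      have h := norm_vSym_le_one hn p ρ
      have h0 := norm_nonneg (vSym ((n : ℝ)⁻¹) p ρ)
      nlinarith
  have h2 : 0 ≤ (lapSym ((n : ℝ)⁻¹) p)⁻¹ := inv_nonneg.mpr (Finset.sum_nonneg fun _ _ => sq_nonneg _)
  calc (∏ ρ ∈ Finset.univ.erase μ, ‖vSym ((n : ℝ)⁻¹) p ρ‖ ^ 2) * (lapSym ((n : ℝ)⁻¹) p)⁻¹
      ≤ 1 * (lapSym ((n : ℝ)⁻¹) p)⁻¹ := mul_le_mul_of_nonneg_right h1 h2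
    _ = (lapSym ((n : ℝ)⁻¹) p)⁻¹ := one_mul _

/-- The l ≠ 0 terms: (|u/v_μ|²Δ^{−1})(p + l) ≤ ¼Π_ρ w(m_ρ) for l = 2πm, m ≠ 0 (2M + 1 ≤ n, 0 < |p_i| ≤ π).  If m_μ ≠ 0 use
Δ(p + l) ≥ |∂_μ(p + l)|² ≥ 4m_μ²; if m_μ = 0 some other m_{ρ₀} ≠ 0 gives Δ(p + l) ≥ 4, and w(m_μ) = 1.
[cite: BalabanImbrieJaffe1985, (7.1.23) p.324] -/
theorem aTerm_shift_le {n M : ℕ} (hMn : 2 * M + 1 ≤ n) {p : Fin d → ℝ} (hp : ∀ i, p i ≠ 0 ∧ |p i| ≤ π)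
    {m : Fin d → ℤ} (hm : m ∈ lShifts d M) (hm0 : m ≠ 0) (μ : Fin d) :
    (‖uSym ((n : ℝ)⁻¹) (shiftMom p m) / vSym ((n : ℝ)⁻¹) (shiftMom p m) μ‖ ^ 2 * (lapSym ((n : ℝ)⁻¹) (shiftMom p m))⁻¹)
      ≤ 1 / 4 * ∏ ρ, (1 / (m ρ : ℝ) ^ 2 + if m ρ = 0 then (1 : ℝ) else 0) := by
  have hn : 0 < n := by omega
  have hv := (generic_shift hn hp m μ).2.2
  rw [aTerm_eq_prod hv]
  set q := shiftMom p m with hq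
  -- Π_{ρ≠μ}|v_ρ(q)|² ≤ Π_{ρ≠μ} w(m_ρ)
  have hprod : ∏ ρ ∈ Finset.univ.erase μ, ‖vSym ((n : ℝ)⁻¹) q ρ‖ ^ 2
      ≤ ∏ ρ ∈ Finset.univ.erase μ, (1 / (m ρ : ℝ) ^ 2 + if m ρ = 0 then (1 : ℝ) else 0) :=
    Finset.prod_le_prod (fun _ _ => sq_nonneg _) fun ρ _ => norm_vSym_shift_sq_le_wgt hMn (hp ρ).2 hm
  have hprod0 : 0 ≤ ∏ ρ ∈ Finset.univ.erase μ, (1 / (m ρ : ℝ) ^ 2 + if m ρ = 0 then (1 : ℝ) else 0) :=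
    Finset.prod_nonneg fun ρ _ => wgt_nonneg _
  have hlap0 : 0 ≤ (lapSym ((n : ℝ)⁻¹) q)⁻¹ := inv_nonneg.mpr (Finset.sum_nonneg fun _ _ => sq_nonneg _)
  have hsplit : ∏ ρ, (1 / (m ρ : ℝ) ^ 2 + if m ρ = 0 then (1 : ℝ) else 0)
      = (1 / (m μ : ℝ) ^ 2 + if m μ = 0 then (1 : ℝ) else 0) * ∏ ρ ∈ Finset.univ.erase μ, (1 / (m ρ : ℝ) ^ 2 + if m ρ = 0 then (1 : ℝ) else 0) :=
    (Finset.mul_prod_erase Finset.univ (fun ρ => (1 / (m ρ : ℝ) ^ 2 + if m ρ = 0 then (1 : ℝ) else 0))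
      (Finset.mem_univ μ)).symm
  by_cases hμ : m μ = 0
  · -- some other coordinate is nonzero
    obtain ⟨ρ₀, hρ₀⟩ : ∃ ρ₀, m ρ₀ ≠ 0 := by
      by_contra h
      exact hm0 (funext fun ρ => not_not.mp (not_exists.mp h ρ))
    have hlap : (lapSym ((n : ℝ)⁻¹) q)⁻¹ ≤ 1 / 4 := by
      have h := inv_lapSym_shift_le hMn (hp ρ₀).2 hm hρ₀
      have hm1 : 1 ≤ (m ρ₀ : ℝ) ^ 2 := by
        have : 1 ≤ |(m ρ₀ : ℝ)| := by
          rw [← Int.cast_abs, ← Int.cast_one]; exact_mod_cast Int.one_le_abs hρ₀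
        nlinarith [abs_nonneg (m ρ₀ : ℝ), sq_abs (m ρ₀ : ℝ)]
      have : 1 / (m ρ₀ : ℝ) ^ 2 ≤ 1 := by rw [div_le_one (by positivity)]; exact hm1
      linarith
    have hw : (1 / (m μ : ℝ) ^ 2 + if m μ = 0 then (1 : ℝ) else 0) = 1 := by simp [hμ]
    calc (∏ ρ ∈ Finset.univ.erase μ, ‖vSym ((n : ℝ)⁻¹) q ρ‖ ^ 2) * (lapSym ((n : ℝ)⁻¹) q)⁻¹
        ≤ (∏ ρ ∈ Finset.univ.erase μ, (1 / (m ρ : ℝ) ^ 2 + if m ρ = 0 then (1 : ℝ) else 0)) * (1 / 4) := mul_le_mul hprod hlap hlap0 hprod0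
      _ = 1 / 4 * ∏ ρ, (1 / (m ρ : ℝ) ^ 2 + if m ρ = 0 then (1 : ℝ) else 0) := by rw [hsplit, hw, one_mul, mul_comm]
  · have hlap : (lapSym ((n : ℝ)⁻¹) q)⁻¹ ≤ 1 / 4 * (1 / (m μ : ℝ) ^ 2) := inv_lapSym_shift_le hMn (hp μ).2 hm hμ
    have hw : (1 / (m μ : ℝ) ^ 2 + if m μ = 0 then (1 : ℝ) else 0) = 1 / (m μ : ℝ) ^ 2 := by simp [hμ]
    calc (∏ ρ ∈ Finset.univ.erase μ, ‖vSym ((n : ℝ)⁻¹) q ρ‖ ^ 2) * (lapSym ((n : ℝ)⁻¹) q)⁻¹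
        ≤ (∏ ρ ∈ Finset.univ.erase μ, (1 / (m ρ : ℝ) ^ 2 + if m ρ = 0 then (1 : ℝ) else 0)) * (1 / 4 * (1 / (m μ : ℝ) ^ 2)) :=
          mul_le_mul hprod hlap hlap0 hprod0
      _ = 1 / 4 * ∏ ρ, (1 / (m ρ : ℝ) ^ 2 + if m ρ = 0 then (1 : ℝ) else 0) := by rw [hsplit, hw]; ring

/-- Σ_{|j| ≤ M} w(j) ≤ K₀, uniformly in M. [cite: BalabanImbrieJaffe1985, (7.1.23) p.324] -/
theorem sum_wgt_le (M : ℕ) :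
    ∑ j ∈ Finset.Icc (-(M : ℤ)) M, (1 / (j : ℝ) ^ 2 + if j = 0 then (1 : ℝ) else 0) ≤ (1 + ∑' j : ℤ, 1 / (j : ℝ) ^ 2) := by
  rw [Finset.sum_add_distrib, Finset.sum_ite_eq' (Finset.Icc (-(M : ℤ)) M) 0 (fun _ => (1 : ℝ)),
    if_pos (by simp), add_comm]
  gcongr
  · exact Summable.sum_le_tsum _ (fun i _ => by positivity) (Real.summable_one_div_int_pow.mpr one_lt_two)

/-- 1 ≤ K₀. [cite: BalabanImbrieJaffe1985, (7.1.23) p.324] -/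
theorem one_le_kay : (1 : ℝ) ≤ (1 + ∑' j : ℤ, 1 / (j : ℝ) ^ 2) := by
  have : 0 ≤ ∑' j : ℤ, 1 / (j : ℝ) ^ 2 := tsum_nonneg fun j => by positivity
  linarith

/-- **Σ_l (|u/v_μ|²Δ^{−1})(p + l) ≤ 1/Δ(p) + ¼K₀^d**, uniformly in n, M (2M + 1 ≤ n) and p (0 < |p_i| ≤ π).
[cite: BalabanImbrieJaffe1985, (7.1.23) p.324] -/
theorem sum_aTerm_le {n M : ℕ} (hMn : 2 * M + 1 ≤ n) {p : Fin d → ℝ} (hp : ∀ i, p i ≠ 0 ∧ |p i| ≤ π) (μ : Fin d) :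
    ∑ m ∈ lShifts d M, (‖uSym ((n : ℝ)⁻¹) (shiftMom p m) / vSym ((n : ℝ)⁻¹) (shiftMom p m) μ‖ ^ 2 * (lapSym ((n : ℝ)⁻¹) (shiftMom p m))⁻¹)
      ≤ (lapSym ((n : ℝ)⁻¹) p)⁻¹ + 1 / 4 * (1 + ∑' j : ℤ, 1 / (j : ℝ) ^ 2) ^ d := by
  have hn : 0 < n := by omega
  rw [← Finset.add_sum_erase (lShifts d M) _ (zero_mem_lShifts d M), shiftMom_zero]
  have h0 := aTerm_zero_le hn hp μ
  -- the l ≠ 0 terms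
  have h1 : ∑ m ∈ (lShifts d M).erase 0,
        (‖uSym ((n : ℝ)⁻¹) (shiftMom p m) / vSym ((n : ℝ)⁻¹) (shiftMom p m) μ‖ ^ 2 * (lapSym ((n : ℝ)⁻¹) (shiftMom p m))⁻¹)
      ≤ ∑ m ∈ (lShifts d M).erase 0, 1 / 4 * ∏ ρ, (1 / (m ρ : ℝ) ^ 2 + if m ρ = 0 then (1 : ℝ) else 0) :=
    Finset.sum_le_sum fun m hm => aTerm_shift_le hMn hp (Finset.mem_of_mem_erase hm) (Finset.ne_of_mem_erase hm) μ
  have h2 : ∑ m ∈ (lShifts d M).erase 0, 1 / 4 * ∏ ρ, (1 / (m ρ : ℝ) ^ 2 + if m ρ = 0 then (1 : ℝ) else 0)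
      ≤ ∑ m ∈ lShifts d M, 1 / 4 * ∏ ρ, (1 / (m ρ : ℝ) ^ 2 + if m ρ = 0 then (1 : ℝ) else 0) :=
    Finset.sum_le_sum_of_subset_of_nonneg (Finset.erase_subset _ _) fun m _ _ =>
      mul_nonneg (by norm_num) (Finset.prod_nonneg fun ρ _ => wgt_nonneg _)
  have h3 : ∑ m ∈ lShifts d M, 1 / 4 * ∏ ρ, (1 / (m ρ : ℝ) ^ 2 + if m ρ = 0 then (1 : ℝ) else 0)
      = 1 / 4 * (∑ j ∈ Finset.Icc (-(M : ℤ)) M, (1 / (j : ℝ) ^ 2 + if j = 0 then (1 : ℝ) else 0)) ^ d := by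
    rw [← Finset.mul_sum, lShifts, ← Finset.prod_univ_sum (fun _ : Fin d => Finset.Icc (-(M : ℤ)) M)
      fun _ j => (1 / (j : ℝ) ^ 2 + if j = 0 then (1 : ℝ) else 0), Finset.prod_const, Finset.card_univ, Fintype.card_fin]
  have h4 : (∑ j ∈ Finset.Icc (-(M : ℤ)) M, (1 / (j : ℝ) ^ 2 + if j = 0 then (1 : ℝ) else 0)) ^ d
      ≤ (1 + ∑' j : ℤ, 1 / (j : ℝ) ^ 2) ^ d :=
    pow_le_pow_left₀ (Finset.sum_nonneg fun j _ => wgt_nonneg j) (sum_wgt_le M) d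
  linarith

/-- **|a_μ(p)| ≤ |∂^{(1)}_μ(p)|·(1/Δ(p) + ¼K₀^d)** ((7.1.16) summed). [cite: BalabanImbrieJaffe1985, (7.1.23) p.324] -/
theorem norm_aSym_le {n M : ℕ} (hMn : 2 * M + 1 ≤ n) {p : Fin d → ℝ} (hp : ∀ i, p i ≠ 0 ∧ |p i| ≤ π) (μ : Fin d) :
    ‖aSym ((n : ℝ)⁻¹) M p μ‖ ≤ ‖dOne p μ‖ * ((lapSym ((n : ℝ)⁻¹) p)⁻¹ + 1 / 4 * (1 + ∑' j : ℤ, 1 / (j : ℝ) ^ 2) ^ d) := by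
  rw [aSym_eq, norm_mul, Complex.norm_real, Real.norm_eq_abs,
    abs_of_nonneg (Finset.sum_nonneg fun m _ => aTerm_nonneg _ _ _)]
  exact mul_le_mul_of_nonneg_left (sum_aTerm_le hMn hp μ) (norm_nonneg _)

/-! ## §3 φ_ν from below, Δ from above -/

/-- **φ_ν(p) ≥ (2/π)^{2d+2}/Δ(p)**: the l = 0 term |u(p)v_ν(p)|²/Δ(p) of (7.1.10) with (7.1.20) for u and v (0 < |p_i| ≤ π,
0 < η ≤ 1, any cut-off M). [cite: BalabanImbrieJaffe1985, (7.1.10) p.322] -/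
theorem phiSym_ge {η : ℝ} (hη0 : 0 < η) (hη1 : η ≤ 1) (M : ℕ) {p : Fin d → ℝ} (hp : ∀ i, p i ≠ 0 ∧ |p i| ≤ π)
    (hΔ : 0 < lapSym η p) (ν : Fin d) : (2 / π) ^ (2 * d + 2) * (lapSym η p)⁻¹ ≤ phiSym η M p ν := by
  have hu := (norm_uSym_bounds hη0 hη1 (fun i => (hp i).1) (fun i => (hp i).2)).1
  have hv := (norm_vSym_bounds hη0 hη1 (hp ν).1 (hp ν).2).1
  have h2π : 0 < 2 / π := by positivity
  calc (2 / π) ^ (2 * d + 2) * (lapSym η p)⁻¹ = ((2 / π) ^ d * (2 / π)) ^ 2 * (lapSym η p)⁻¹ := by ring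
    _ ≤ (‖uSym η p‖ * ‖vSym η p ν‖) ^ 2 * (lapSym η p)⁻¹ :=
        mul_le_mul_of_nonneg_right
          (pow_le_pow_left₀ (mul_nonneg (pow_nonneg h2π.le d) h2π.le) (mul_le_mul hu hv h2π.le (norm_nonneg _)) 2)
          (inv_nonneg.mpr hΔ.le)
    _ = ‖uSym η (shiftMom p 0) * vSym η (shiftMom p 0) ν‖ ^ 2 * (lapSym η (shiftMom p 0))⁻¹ := by
        rw [shiftMom_zero, norm_mul]
    _ ≤ phiSym η M p ν :=
        Finset.single_le_sum (f := fun m => ‖uSym η (shiftMom p m) * vSym η (shiftMom p m) ν‖ ^ 2 *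
          (lapSym η (shiftMom p m))⁻¹)
          (fun m _ => mul_nonneg (sq_nonneg _) (inv_nonneg.mpr (Finset.sum_nonneg fun _ _ => sq_nonneg _)))
          (zero_mem_lShifts d M)

/-- φ_ν(p) > 0 at such momenta. [cite: BalabanImbrieJaffe1985, (7.1.10) p.322] -/
theorem phiSym_pos {η : ℝ} (hη0 : 0 < η) (hη1 : η ≤ 1) (M : ℕ) {p : Fin d → ℝ} (hp : ∀ i, p i ≠ 0 ∧ |p i| ≤ π)
    (hΔ : 0 < lapSym η p) (ν : Fin d) : 0 < phiSym η M p ν :=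
  lt_of_lt_of_le (by positivity) (phiSym_ge hη0 hη1 M hp hΔ ν)

/-- Δ(p) ≤ dπ² for |p_i| ≤ π (|∂_ρ(p)| = 2n|sin(p_ρ/2n)| ≤ |p_ρ| ≤ π). [cite: BalabanImbrieJaffe1985, (7.1.6) p.322] -/
theorem lapSym_le {n : ℕ} (hn : 0 < n) {p : Fin d → ℝ} (hp : ∀ i, |p i| ≤ π) : lapSym ((n : ℝ)⁻¹) p ≤ d * π ^ 2 := by
  have hn' : (0 : ℝ) < n := by exact_mod_cast hn
  have h : ∀ ρ, ‖dSym ((n : ℝ)⁻¹) p ρ‖ ^ 2 ≤ π ^ 2 := fun ρ => by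
    rw [norm_dSym_inv_nat hn]
    have h1 : |Real.sin (p ρ / (2 * n))| ≤ |p ρ| / (2 * n) := by
      have := Real.abs_sin_le_abs (x := p ρ / (2 * n))
      rwa [abs_div, abs_of_pos (by positivity : (0 : ℝ) < 2 * n)] at this
    have h2 : 2 * n * |Real.sin (p ρ / (2 * n))| ≤ |p ρ| := by
      calc 2 * n * |Real.sin (p ρ / (2 * n))| ≤ 2 * n * (|p ρ| / (2 * n)) := by gcongr
        _ = |p ρ| := by field_simp
    calc (2 * n * |Real.sin (p ρ / (2 * n))|) ^ 2 ≤ |p ρ| ^ 2 := pow_le_pow_left₀ (by positivity) h2 2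
      _ ≤ π ^ 2 := pow_le_pow_left₀ (abs_nonneg _) (hp ρ) 2
  calc lapSym ((n : ℝ)⁻¹) p = ∑ ρ, ‖dSym ((n : ℝ)⁻¹) p ρ‖ ^ 2 := rfl
    _ ≤ ∑ _ρ : Fin d, π ^ 2 := Finset.sum_le_sum fun ρ _ => h ρ
    _ = d * π ^ 2 := by rw [Finset.sum_const, Finset.card_univ, Fintype.card_fin, nsmul_eq_mul]

/-- |∂^{(1)}_λ(p)|² ≤ Δ(p) (η = 1/n). [cite: BalabanImbrieJaffe1985, (7.1.6) p.322] -/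
theorem norm_dOne_sq_le_lapSym {n : ℕ} (hn : 0 < n) (p : Fin d → ℝ) (μ : Fin d) :
    ‖dOne p μ‖ ^ 2 ≤ lapSym ((n : ℝ)⁻¹) p :=
  calc ‖dOne p μ‖ ^ 2 ≤ ‖dSym ((n : ℝ)⁻¹) p μ‖ ^ 2 := pow_le_pow_left₀ (norm_nonneg _) (norm_dOne_le_norm_dSym hn p μ) 2
    _ ≤ lapSym ((n : ℝ)⁻¹) p :=
        Finset.single_le_sum (f := fun i => ‖dSym ((n : ℝ)⁻¹) p i‖ ^ 2) (fun _ _ => sq_nonneg _) (Finset.mem_univ μ)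

end

end Literature.MathematicalPhysics.QuantumFieldTheory.BalabanImbrieJaffe1984to88.BIJ85AveragingSums716
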